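import Summits.QuantumFields.YangMills.Theorems.BalabanUVNodesN15KingModelHeatKernelGradientProductMajorants
import HarnessLib

/-!
# BalabanUVNodes ∕ N15 — THE KING-MODEL RUNG (PART ∇-j): THE ℓ¹ NORMS OF THE CYCLE HEAT KERNEL AND OF ITS DIFFERENCE —
# `Σ_{n∈ℤ∕K}‖Q^{(K)}_s(n)‖ ≤ 60` and `Σ_{n∈ℤ∕K}‖∇Q^{(K)}_s(n)‖ ≤ 142∕√s` for every `s > 0`, every `K ≥ 1` (absolute constants; the half-power `s^{−1∕2}` is the total variation of a kernel of height `s^{−1∕2}`)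
# (the one-dimensional input of PART ∇-k: the ℓ¹ norm of the lattice gradient of King's covariance is `O(1∕(m√c))` — the extra power of `η` that the full propagator's block correction needs)
# (Track A, DAG node N15 = NE2; FAN-OUT v1.1 §N15 s3 «KING-MODEL RUNG … + what the curved case adds»; count-neutral)

HONEST FRAMING.  Count-neutral (cell `pub-ymgap`, seat `pub-ymgap-dag-n15-e` g57; `--supports stmt-QuantumFields-27247 --as helper` = K3ᴬ).  Finite sums on `ℤ∕K` about PART Ϣ-d's `Q_s` and
PART ∇-b's `∇Q_s`; no field theory.  The true values are `Σ_nQ_s(n) = 1` (a Markov kernel) and `Σ_n|∇Q_s(n)| = 2·max_nQ_s(n) ≍ min(2, s^{−1∕2})` (a unimodal kernel); this file proves the cruder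
`≤ 60` and `≤ 142∕√s` from the bounds already in the tree — (B1)∕(B2)∕(B3) for `Q_s` (PART Ϣ-g) and (G1)∕(G2)∕(G3) for `∇Q_s` (PART ∇-d) — by a HEAD–TAIL split at `|v| = 12√s` resp. `30√s`: the
head pays the mixing bound per class, the tail pays the `|v|⁻⁴` decay summed by comparison with `∫x⁻⁴dx` (`Σ_{w>ρ}w⁻⁴ ≤ 1∕(3ρ³)`), and beyond the mixing time (`s ≥ K²∕4`) everything is the mixing
bound times `K`.  No positivity and no character orthogonality is used (they would give the sharp `Σ_nQ_s(n) = 1`; not needed).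
CONTENTS.  §1 the tail `Σ_{i∈Ico ρ N}1∕(i+1)⁴ ≤ 1∕(3ρ³)` (★ `sum_Ico_inv_pow_four_le`) and the generic head–tail lemma ★ `sum_range_le_head_add_tail`; §2 ★ `gradDecayPoly_le` (PART ∇-d's bracket
`D(r,N) ≤ 13053r²` for `1 ≤ r`, `2r ≤ N`); §3 ★★★ **`sum_norm_cycleHeat_le`** (`Σ_n‖Q_s(n)‖ ≤ 60`); §4 `sum_norm_cycleHeatGrad_le_hundred_twenty`, ★★★ **`sum_norm_cycleHeatGrad_le`** (`Σ_n‖∇Q_s(n)‖ ≤ 142∕√s`).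
PRIOR TREE ART (by name): PART Ϣ-c `sum_univ_absV_le`, Ϣ-d `norm_cycleHeat_le_one`, Ϣ-g `norm_cycleHeat_le_inv_add_inv_sqrt` ∕ `norm_cycleHeat_le_poly_div`, ∇-b `norm_cycleHeatGrad_le_two`, ∇-d
`norm_cycleHeatGrad_le_two_div` ∕ `norm_cycleHeatGrad_le_decayPoly`; Mathlib `AntitoneOn.sum_le_integral_Ico`, `integral_rpow`.
Dedup (rg at filing): basename 0 files; needles `sum_norm_cycleHeat_le|sum_norm_cycleHeatGrad_le|sum_Ico_inv_pow_four_le|sum_range_le_head_add_tail|gradDecayPoly_le` 0 tree files.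
Locators: [King1986] (4.4) p.670, (4.35) p.674, (3.63) p.663; [LawlerLimic2010] §2.3 ∕ Prop. 2.4.4 (heat-kernel gradient `ℓ¹` bounds).  0 `sorry`, 0 `def`.
-/

noncomputable section

open Real Set Finset MeasureTheory
open scoped BigOperators

namespace Summit.QuantumFields.YangMills.BalabanUVNodes.N15KingModelRung.HeatKernel

/-! ## §1 The tail `Σ_{w>ρ} w⁻⁴ ≤ 1∕(3ρ³)` and the head–tail split -/

/-- ★ `Σ_{i∈[ρ,N)} 1∕(i+1)⁴ ≤ 1∕(3ρ³)` for `ρ ≥ 1` (antitone comparison with `∫_ρ^N x⁻⁴dx = (ρ⁻³ − N⁻³)∕3`). [folklore] -/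
theorem sum_Ico_inv_pow_four_le {ρ : ℕ} (hρ : 1 ≤ ρ) (N : ℕ) :
    ∑ i ∈ Finset.Ico ρ N, 1 / (((i + 1 : ℕ) : ℝ)) ^ 4 ≤ 1 / (3 * (ρ : ℝ) ^ 3) := by
  have hρr : (1 : ℝ) ≤ ρ := by exact_mod_cast hρ
  have hρ0 : (0 : ℝ) < ρ := by linarith
  rcases le_or_gt N ρ with hN | hN
  · rw [Finset.Ico_eq_empty_of_le hN, Finset.sum_empty]; positivity
  have hanti : AntitoneOn (fun x : ℝ => x ^ (-4 : ℝ)) (Icc (ρ : ℝ) (N : ℝ)) := by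
    intro x hx y hy hxy
    have hx0 : 0 < x := lt_of_lt_of_le hρ0 hx.1
    exact Real.rpow_le_rpow_of_nonpos hx0 hxy (by norm_num)
  have h1 := AntitoneOn.sum_le_integral_Ico hN.le hanti
  have hsum : ∑ i ∈ Finset.Ico ρ N, 1 / (((i + 1 : ℕ) : ℝ)) ^ 4 = ∑ i ∈ Finset.Ico ρ N, (((i + 1 : ℕ) : ℝ)) ^ (-4 : ℝ) := by
    refine Finset.sum_congr rfl fun i _ => ?_
    rw [show (-4 : ℝ) = -((4 : ℕ) : ℝ) by norm_num, Real.rpow_neg (by positivity), Real.rpow_natCast, one_div]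
  rw [hsum]
  refine h1.trans ?_
  have h0 : (0 : ℝ) ∉ Set.uIcc (ρ : ℝ) (N : ℝ) := by
    rw [Set.uIcc_of_le (by exact_mod_cast hN.le)]
    intro h; exact absurd h.1 (not_le.mpr hρ0)
  rw [integral_rpow (Or.inr ⟨by norm_num, h0⟩)]
  have hN0 : (0 : ℝ) < N := lt_trans hρ0 (by exact_mod_cast hN)
  have hN' : (N : ℝ) ^ ((-4 : ℝ) + 1) = ((N : ℝ) ^ 3)⁻¹ := by
    rw [show (-4 : ℝ) + 1 = -((3 : ℕ) : ℝ) by norm_num, Real.rpow_neg hN0.le, Real.rpow_natCast]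
  have hρ' : (ρ : ℝ) ^ ((-4 : ℝ) + 1) = ((ρ : ℝ) ^ 3)⁻¹ := by
    rw [show (-4 : ℝ) + 1 = -((3 : ℕ) : ℝ) by norm_num, Real.rpow_neg hρ0.le, Real.rpow_natCast]
  rw [hN', hρ', show (-4 : ℝ) + 1 = -3 by norm_num]
  have hN3 : 0 ≤ ((N : ℝ) ^ 3)⁻¹ := by positivity
  have e : (((N : ℝ) ^ 3)⁻¹ - ((ρ : ℝ) ^ 3)⁻¹) / (-3) = (((ρ : ℝ) ^ 3)⁻¹ - ((N : ℝ) ^ 3)⁻¹) / 3 := by ring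
  rw [e, one_div, mul_inv, show ((3 : ℝ))⁻¹ * ((ρ : ℝ) ^ 3)⁻¹ = ((ρ : ℝ) ^ 3)⁻¹ / 3 by ring]
  exact div_le_div_of_nonneg_right (by linarith) (by norm_num)

/-- ★ THE HEAD–TAIL SPLIT: if `0 ≤ g(i) ≤ M` for all `i` and `g(i) ≤ P∕(i+1)⁴` for all `i` (`P ≥ 0`), then for `ρ ≥ 1`: `Σ_{i<N} g(i) ≤ ρ·M + P∕(3ρ³)`. [folklore] -/
theorem sum_range_le_head_add_tail {g : ℕ → ℝ} {M P : ℝ} (hg0 : ∀ i, 0 ≤ g i) (hgM : ∀ i, g i ≤ M) (hgP : ∀ i, g i ≤ P / (((i + 1 : ℕ) : ℝ)) ^ 4) (hP : 0 ≤ P)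
    {ρ : ℕ} (hρ : 1 ≤ ρ) (N : ℕ) : ∑ i ∈ Finset.range N, g i ≤ ρ * M + P / (3 * (ρ : ℝ) ^ 3) := by
  have hsub : Finset.range N ⊆ Finset.range ρ ∪ Finset.Ico ρ N := by
    intro i hi
    rw [Finset.mem_union, Finset.mem_range, Finset.mem_Ico]
    rw [Finset.mem_range] at hi
    omega
  have hdisj : Disjoint (Finset.range ρ) (Finset.Ico ρ N) := by
    rw [Finset.disjoint_left]; intro i hi hi'
    rw [Finset.mem_range] at hi; rw [Finset.mem_Ico] at hi'; omega
  calc ∑ i ∈ Finset.range N, g i ≤ ∑ i ∈ Finset.range ρ ∪ Finset.Ico ρ N, g i := Finset.sum_le_sum_of_subset_of_nonneg hsub fun i _ _ => hg0 i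
    _ = ∑ i ∈ Finset.range ρ, g i + ∑ i ∈ Finset.Ico ρ N, g i := Finset.sum_union hdisj
    _ ≤ ∑ _i ∈ Finset.range ρ, M + ∑ i ∈ Finset.Ico ρ N, P * (1 / (((i + 1 : ℕ) : ℝ)) ^ 4) :=
        add_le_add (Finset.sum_le_sum fun i _ => hgM i) (Finset.sum_le_sum fun i _ => by rw [mul_one_div]; exact hgP i)
    _ = ρ * M + P * ∑ i ∈ Finset.Ico ρ N, 1 / (((i + 1 : ℕ) : ℝ)) ^ 4 := by rw [Finset.sum_const, Finset.card_range, nsmul_eq_mul, Finset.mul_sum]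
    _ ≤ ρ * M + P * (1 / (3 * (ρ : ℝ) ^ 3)) := add_le_add le_rfl (mul_le_mul_of_nonneg_left (sum_Ico_inv_pow_four_le hρ N) hP)
    _ = ρ * M + P / (3 * (ρ : ℝ) ^ 3) := by ring

/-- The split radius: for `r ≥ 1` and `λ ≥ 1` natural, `ρ = ⌊λr⌋₊` satisfies `ρ ≥ 1`, `ρ ≤ λr` and `λr∕2 ≤ ρ` (so `1∕ρ³ ≤ 8∕(λr)³`). [folklore] -/
theorem floor_props {r : ℝ} (hr : 1 ≤ r) {lam : ℕ} (hlam : 1 ≤ lam) :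
    1 ≤ ⌊(lam : ℝ) * r⌋₊ ∧ (⌊(lam : ℝ) * r⌋₊ : ℝ) ≤ (lam : ℝ) * r ∧ (lam : ℝ) * r / 2 ≤ (⌊(lam : ℝ) * r⌋₊ : ℝ) := by
  have hl : (1 : ℝ) ≤ lam := by exact_mod_cast hlam
  have hx : (1 : ℝ) ≤ (lam : ℝ) * r := one_le_mul_of_one_le_of_one_le hl hr
  have hx0 : (0 : ℝ) ≤ (lam : ℝ) * r := by linarith
  refine ⟨?_, Nat.floor_le hx0, ?_⟩
  · have := Nat.le_floor (a := (lam : ℝ) * r) (n := 1) (by exact_mod_cast hx); exact this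
  · have h := Nat.lt_floor_add_one ((lam : ℝ) * r)
    have h1 : (1 : ℝ) ≤ (⌊(lam : ℝ) * r⌋₊ : ℝ) := by
      have := Nat.le_floor (a := (lam : ℝ) * r) (n := 1) (by exact_mod_cast hx)
      exact_mod_cast this
    by_cases h2 : 2 ≤ (lam : ℝ) * r
    · linarith
    · push Not at h2; linarith

/-! ## §2 PART ∇-d's decay bracket is `O(r²)` -/

/-- ★ `D(r,N) = (1+12r+24r²+60r³)(9∕N+1∕r) + (14r²+84r⁴)·7·(56∕N²+1∕(4r²)+8∕(Nr)) ≤ 13053r²` for `1 ≤ r`, `2r ≤ N` (the `r ≥ 1` half of PART ∇-d's first numeric heart). [folklore] -/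
theorem gradDecayPoly_le {r N : ℝ} (hr : 1 ≤ r) (hrN : 2 * r ≤ N) :
    (1 + 12 * r + 24 * r ^ 2 + 60 * r ^ 3) * (9 / N + 1 / r) + (14 * r ^ 2 + 84 * r ^ 4) * 7 * (56 / N ^ 2 + 1 / (4 * r ^ 2) + 8 / (N * r)) ≤ 13053 * r ^ 2 := by
  have hr0 : 0 < r := by linarith
  have hNpos : 0 < N := by linarith
  have hF1 : 9 / N + 1 / r ≤ 11 / (2 * r) := by
    have h9 : 9 / N ≤ 9 / (2 * r) := div_le_div_of_nonneg_left (by norm_num) (by positivity) hrN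
    have e : 11 / (2 * r) = 9 / (2 * r) + 1 / r := by field_simp; norm_num
    rw [e]; linarith
  have hF10 : 0 ≤ 9 / N + 1 / r := by positivity
  have h12 : r ≤ r ^ 2 := by nlinarith
  have h23 : r ^ 2 ≤ r ^ 3 := pow_le_pow_right₀ hr (by norm_num)
  have h24 : r ^ 2 ≤ r ^ 4 := pow_le_pow_right₀ hr (by norm_num)
  have h03 : 1 ≤ r ^ 3 := one_le_pow₀ hr
  have hP1 : 1 + 12 * r + 24 * r ^ 2 + 60 * r ^ 3 ≤ 97 * r ^ 3 := by linarith
  have hP2 : 14 * r ^ 2 + 84 * r ^ 4 ≤ 98 * r ^ 4 := by linarith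
  have hF2 : 56 / N ^ 2 + 1 / (4 * r ^ 2) + 8 / (N * r) ≤ 73 / (4 * r ^ 2) := by
    have h1 : 56 / N ^ 2 ≤ 56 / (2 * r) ^ 2 := div_le_div_of_nonneg_left (by norm_num) (by positivity) (pow_le_pow_left₀ (by positivity) hrN 2)
    have h2 : 8 / (N * r) ≤ 8 / (2 * r * r) := div_le_div_of_nonneg_left (by norm_num) (by positivity) (mul_le_mul_of_nonneg_right hrN hr0.le)
    have e : 73 / (4 * r ^ 2) = 56 / (2 * r) ^ 2 + 1 / (4 * r ^ 2) + 8 / (2 * r * r) := by field_simp; ring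
    rw [e]; linarith
  have hA : (1 + 12 * r + 24 * r ^ 2 + 60 * r ^ 3) * (9 / N + 1 / r) ≤ 97 * r ^ 3 * (11 / (2 * r)) := mul_le_mul hP1 hF1 hF10 (by positivity)
  have hB : (14 * r ^ 2 + 84 * r ^ 4) * 7 * (56 / N ^ 2 + 1 / (4 * r ^ 2) + 8 / (N * r)) ≤ 98 * r ^ 4 * 7 * (73 / (4 * r ^ 2)) := by gcongr
  have e : 97 * r ^ 3 * (11 / (2 * r)) + 98 * r ^ 4 * 7 * (73 / (4 * r ^ 2)) = 13053 * r ^ 2 := by field_simp; ring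
  linarith

/-! ## §3 The ℓ¹ norm of the cycle heat kernel -/

variable {K : ℕ} [NeZero K]
set_option maxHeartbeats 400000 in
/-- ★★★ **`Σ_{n∈ℤ∕K}‖Q^{(K)}_s(n)‖ ≤ 60`** for every `s > 0`, every `K ≥ 1` — beyond the mixing time (`4s ≥ K²`) each of the `K` classes costs `1∕K + 1∕√s ≤ 3∕K`; before it, the head `|v| ≤ 12√s′`
(`s′ = max(s,1)`) pays `min(1, 1∕K+1∕√s) ≤ 3∕(2√s′)` per class (`≤ 18` in all) and the tail pays PART Ϣ-g's `(98s+588s²)(9∕K+1∕√s)|v|⁻⁴ ≤ 6860s′^{3∕2}|v|⁻⁴` summed beyond `12√s′` (`≤ 11`).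
[cite: King1986, (4.4) p.670, (4.35) p.674] -/
theorem sum_norm_cycleHeat_le {s : ℝ} (hs : 0 < s) : ∑ n : ZMod K, ‖cycleHeat K s n‖ ≤ 60 := by
  have hK : (0 : ℝ) < K := by exact_mod_cast Nat.pos_of_ne_zero (NeZero.ne K)
  have hK1 : (1 : ℝ) ≤ K := by exact_mod_cast Nat.one_le_iff_ne_zero.mpr (NeZero.ne K)
  set r := Real.sqrt s with hr
  have hr0 : 0 < r := Real.sqrt_pos.mpr hs
  have hrs : r ^ 2 = s := Real.sq_sqrt hs.le
  -- regime (i): beyond the mixing time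
  by_cases hmix : (K : ℝ) ≤ 2 * r
  · have hterm : ∀ n : ZMod K, ‖cycleHeat K s n‖ ≤ 3 / K := by
      intro n
      refine (norm_cycleHeat_le_inv_add_inv_sqrt hs n).trans ?_
      rw [← hr]
      have : r⁻¹ ≤ 2 / K := by rw [inv_eq_one_div, div_le_div_iff₀ hr0 hK]; linarith
      have e : (3 : ℝ) / K = (K : ℝ)⁻¹ + 2 / K := by ring
      rw [e]; linarith
    calc ∑ n : ZMod K, ‖cycleHeat K s n‖ ≤ ∑ _n : ZMod K, (3 : ℝ) / K := Finset.sum_le_sum fun n _ => hterm n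
      _ = 3 := by rw [Finset.sum_const, Finset.card_univ, ZMod.card, nsmul_eq_mul]; field_simp
      _ ≤ 60 := by norm_num
  push Not at hmix
  -- regimes (ii)/(iii): head–tail at `ρ = ⌊12 r'⌋`, `r' = max r 1`
  set r' := max r 1 with hr'
  have hr'1 : 1 ≤ r' := le_max_right _ _
  have hr'0 : 0 < r' := by linarith
  have hrr' : r ≤ r' := le_max_left _ _
  obtain ⟨hρ1, hρle, hρge⟩ := floor_props hr'1 (lam := 12) (by norm_num)
  set ρ := ⌊((12 : ℕ) : ℝ) * r'⌋₊ with hρ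
  -- the per-class majorant through `|v|`
  set M : ℝ := min 1 ((K : ℝ)⁻¹ + r⁻¹) with hM
  set P : ℝ := (98 * s + 588 * s ^ 2) * (9 * (K : ℝ)⁻¹ + (Real.sqrt s)⁻¹) with hP
  have hM0 : 0 ≤ M := le_min zero_le_one (by positivity)
  have hP0 : 0 ≤ P := by positivity
  set φ : ℕ → ℝ := fun w => if w = 0 then M else min M (P / (w : ℝ) ^ 4) with hφ
  have hφ0 : ∀ w, 0 ≤ φ w := fun w => by
    simp only [hφ]; split_ifs
    · exact hM0
    · exact le_min hM0 (by positivity)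
  have hmaj : ∀ n : ZMod K, ‖cycleHeat K s n‖ ≤ φ (n.valMinAbs.natAbs) := by
    intro n
    have hMn : ‖cycleHeat K s n‖ ≤ M := le_min (norm_cycleHeat_le_one hs.le n) (by rw [hr]; exact norm_cycleHeat_le_inv_add_inv_sqrt hs n)
    by_cases hn : n = 0
    · have : n.valMinAbs.natAbs = 0 := by rw [hn]; simp
      simp only [hφ, this, if_true]; exact hMn
    · have hne : n.valMinAbs.natAbs ≠ 0 := by rwa [Ne, Int.natAbs_eq_zero, ZMod.valMinAbs_eq_zero]
      simp only [hφ, hne, if_false]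
      exact le_min hMn (norm_cycleHeat_le_poly_div hs hn)
  have h1 : ∑ n : ZMod K, ‖cycleHeat K s n‖ ≤ ∑ n : ZMod K, φ (n.valMinAbs.natAbs) := Finset.sum_le_sum fun n _ => hmaj n
  have h2 := sum_univ_absV_le (K := K) φ hφ0
  have hφz : φ 0 = M := by simp [hφ]
  rw [hφz] at h2
  -- head–tail for `g i = φ (i+1)`
  have hg0 : ∀ i : ℕ, 0 ≤ φ (i + 1) := fun i => hφ0 _
  have hgM : ∀ i : ℕ, φ (i + 1) ≤ M := fun i => by simp only [hφ, Nat.succ_ne_zero, if_false]; exact min_le_left _ _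
  have hgP : ∀ i : ℕ, φ (i + 1) ≤ P / (((i + 1 : ℕ) : ℝ)) ^ 4 := fun i => by simp only [hφ, Nat.succ_ne_zero, if_false]; exact min_le_right _ _
  have h3 := sum_range_le_head_add_tail hg0 hgM hgP hP0 hρ1 (K / 2)
  -- the head: `ρ·M ≤ 12 r'·(3∕(2 r')) = 18`
  have hMle : M ≤ 3 / (2 * r') := by
    rcases le_or_gt 1 r with hr1 | hr1
    · -- `r ≥ 1`: `r' = r`, `M ≤ 1/K + 1/r ≤ 1/(2r) + 1/r`
      have hr'r : r' = r := max_eq_left hr1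
      have hKr : (K : ℝ)⁻¹ ≤ 1 / (2 * r) := by rw [inv_eq_one_div]; exact div_le_div_of_nonneg_left zero_le_one (by positivity) hmix.le
      calc M ≤ (K : ℝ)⁻¹ + r⁻¹ := min_le_right _ _
        _ ≤ 1 / (2 * r) + 1 / r := by rw [inv_eq_one_div r]; linarith
        _ = 3 / (2 * r') := by rw [hr'r]; ring
    · -- `r < 1`: `r' = 1`, `M ≤ 1`
      have hr'1' : r' = 1 := max_eq_right hr1.le
      rw [hr'1']; exact (min_le_left _ _).trans (by norm_num)
  have hhead : (ρ : ℝ) * M ≤ 18 := by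
    calc (ρ : ℝ) * M ≤ (((12 : ℕ) : ℝ) * r') * (3 / (2 * r')) := mul_le_mul hρle hMle hM0 (by positivity)
      _ = 18 := by field_simp; norm_num
  -- the tail: `P ≤ 3773 r'³`, `1∕(3ρ³) ≤ 8∕(3·(12r')³)`
  have hPle : P ≤ 6860 * r' ^ 3 := by
    have hsr : Real.sqrt s = r := hr.symm
    rw [hP, hsr, ← hrs]
    rcases le_or_gt 1 r with hr1 | hr1
    · have hr'r : r' = r := max_eq_left hr1
      have h24 : r ^ 2 ≤ r ^ 4 := pow_le_pow_right₀ hr1 (by norm_num)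
      have hPP : 98 * r ^ 2 + 588 * (r ^ 2) ^ 2 ≤ 686 * r ^ 4 := by nlinarith
      have hF : 9 * (K : ℝ)⁻¹ + r⁻¹ ≤ 11 / (2 * r) := by
        have hKr : (K : ℝ)⁻¹ ≤ 1 / (2 * r) := by rw [inv_eq_one_div]; exact div_le_div_of_nonneg_left zero_le_one (by positivity) hmix.le
        have e : 11 / (2 * r) = 9 * (1 / (2 * r)) + 1 / r := by field_simp; norm_num
        rw [e, inv_eq_one_div r]; linarith
      calc (98 * r ^ 2 + 588 * (r ^ 2) ^ 2) * (9 * (K : ℝ)⁻¹ + r⁻¹) ≤ 686 * r ^ 4 * (11 / (2 * r)) := mul_le_mul hPP hF (by positivity) (by positivity)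
        _ = 3773 * r ^ 3 := by field_simp; ring
        _ ≤ 6860 * r ^ 3 := by nlinarith [pow_pos hr0 3]
        _ = 6860 * r' ^ 3 := by rw [hr'r]
    · have hr'1' : r' = 1 := max_eq_right hr1.le
      rw [hr'1', one_pow, mul_one]
      have hr1' : r ≤ 1 := hr1.le
      have hr2 : r ^ 2 ≤ 1 := pow_le_one₀ hr0.le hr1'
      have hPP : 98 * r ^ 2 + 588 * (r ^ 2) ^ 2 ≤ 686 * r ^ 2 := by nlinarith
      have hF : 9 * (K : ℝ)⁻¹ + r⁻¹ ≤ 9 + r⁻¹ := by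
        have : (K : ℝ)⁻¹ ≤ 1 := inv_le_one_of_one_le₀ hK1
        linarith
      have e1 : r ^ 2 * r⁻¹ = r := by rw [sq, mul_assoc, mul_inv_cancel₀ hr0.ne', mul_one]
      calc (98 * r ^ 2 + 588 * (r ^ 2) ^ 2) * (9 * (K : ℝ)⁻¹ + r⁻¹) ≤ 686 * r ^ 2 * (9 + r⁻¹) := mul_le_mul hPP hF (by positivity) (by positivity)
        _ = 6174 * r ^ 2 + 686 * (r ^ 2 * r⁻¹) := by ring
        _ = 6174 * r ^ 2 + 686 * r := by rw [e1]
        _ ≤ 6174 * 1 + 686 * 1 := by nlinarith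
        _ = 6860 := by norm_num
  have htail : P / (3 * (ρ : ℝ) ^ 3) ≤ 11 := by
    have hρ3 : ((((12 : ℕ) : ℝ) * r') / 2) ^ 3 ≤ (ρ : ℝ) ^ 3 := pow_le_pow_left₀ (by positivity) hρge 3
    have hρpos : 0 < (ρ : ℝ) ^ 3 := lt_of_lt_of_le (by positivity) hρ3
    calc P / (3 * (ρ : ℝ) ^ 3) ≤ 6860 * r' ^ 3 / (3 * ((((12 : ℕ) : ℝ) * r') / 2) ^ 3) := by
          gcongr
      _ = 6860 / 648 := by field_simp; ring
      _ ≤ 11 := by norm_num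
  have hM1 : M ≤ 3 / 2 := hMle.trans (by rw [div_le_div_iff₀ (by positivity) (by norm_num)]; nlinarith)
  calc ∑ n : ZMod K, ‖cycleHeat K s n‖ ≤ M + 2 * ∑ i ∈ Finset.range (K / 2), φ (i + 1) := h1.trans h2
    _ ≤ 3 / 2 + 2 * (18 + 11) := by nlinarith [h3, hhead, htail]
    _ ≤ 60 := by norm_num

/-! ## §4 The ℓ¹ norm of the differenced kernel -/

/-- `Σ_n‖∇Q_s(n)‖ ≤ 2Σ_n‖Q_s(n)‖ ≤ 120` (`s > 0`). [folklore] -/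
theorem sum_norm_cycleHeatGrad_le_hundred_twenty {s : ℝ} (hs : 0 < s) : ∑ n : ZMod K, ‖cycleHeatGrad K s n‖ ≤ 120 := by
  have h1 : ∑ n : ZMod K, ‖cycleHeatGrad K s n‖ ≤ ∑ n : ZMod K, (‖cycleHeat K s (n + 1)‖ + ‖cycleHeat K s n‖) :=
    Finset.sum_le_sum fun n _ => norm_sub_le _ _
  rw [Finset.sum_add_distrib] at h1
  have h2 : ∑ n : ZMod K, ‖cycleHeat K s (n + 1)‖ = ∑ n : ZMod K, ‖cycleHeat K s n‖ :=
    Fintype.sum_equiv (Equiv.addRight (1 : ZMod K)) _ _ (fun n => rfl)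
  have h3 := sum_norm_cycleHeat_le (K := K) hs
  linarith

/-- ★★★ **`Σ_{n∈ℤ∕K}‖∇Q^{(K)}_s(n)‖ ≤ 142∕√s`** for every `s > 0`, every `K ≥ 1` — beyond the mixing time each class costs `2∕s` and `K·2∕s ≤ 4∕√s`; for `1 ≤ s ≤ K²∕4` the head `|v| ≤ 30√s` pays `2∕s` per class
(`≤ 60∕√s`) and the tail pays PART ∇-d's `7·13053s|v|⁻⁴` beyond `30√s` (`≤ 10∕√s`); for `s ≤ 1` the previous lemma's `120 ≤ 142∕√s`.  The HALF-POWER `s^{−1∕2}` is the total variation of a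
kernel of height `s^{−1∕2}` — the source of the extra `η` in PART ∇-k. [cite: King1986, (4.4) p.670, (4.35) p.674, (3.63) p.663] -/
theorem sum_norm_cycleHeatGrad_le {s : ℝ} (hs : 0 < s) : ∑ n : ZMod K, ‖cycleHeatGrad K s n‖ ≤ 142 / Real.sqrt s := by
  have hK : (0 : ℝ) < K := by exact_mod_cast Nat.pos_of_ne_zero (NeZero.ne K)
  set r := Real.sqrt s with hr
  have hr0 : 0 < r := Real.sqrt_pos.mpr hs
  have hrs : r ^ 2 = s := Real.sq_sqrt hs.le
  -- `s ≤ 1`: `120 ≤ 142/√s`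
  rcases le_or_gt r 1 with hr1 | hr1
  · refine (sum_norm_cycleHeatGrad_le_hundred_twenty (K := K) hs).trans ?_
    rw [le_div_iff₀ hr0]; nlinarith
  -- beyond the mixing time
  by_cases hmix : (K : ℝ) ≤ 2 * r
  · have hterm : ∀ n : ZMod K, ‖cycleHeatGrad K s n‖ ≤ 2 / s := fun n => norm_cycleHeatGrad_le_two_div hs n
    calc ∑ n : ZMod K, ‖cycleHeatGrad K s n‖ ≤ ∑ _n : ZMod K, (2 : ℝ) / s := Finset.sum_le_sum fun n _ => hterm n
      _ = K * (2 / s) := by rw [Finset.sum_const, Finset.card_univ, ZMod.card, nsmul_eq_mul]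
      _ ≤ 2 * r * (2 / s) := mul_le_mul_of_nonneg_right hmix (by positivity)
      _ = 4 / r := by rw [← hrs]; field_simp; ring
      _ ≤ 142 / r := div_le_div_of_nonneg_right (by norm_num) hr0.le
  push Not at hmix
  -- `1 ≤ r`, `2r < K`: head–tail at `ρ = ⌊30 r⌋`
  obtain ⟨hρ1, hρle, hρge⟩ := floor_props hr1.le (lam := 30) (by norm_num)
  set ρ := ⌊((30 : ℕ) : ℝ) * r⌋₊ with hρ
  set M : ℝ := 2 / s with hM
  set D : ℝ := 7 * ((1 + 12 * r + 24 * r ^ 2 + 60 * r ^ 3) * (9 / K + 1 / r) + (14 * r ^ 2 + 84 * r ^ 4) * 7 * (56 / (K : ℝ) ^ 2 + 1 / (4 * r ^ 2) + 8 / (K * r))) with hD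
  have hM0 : 0 ≤ M := by positivity
  have hD0 : 0 ≤ D := by positivity
  set φ : ℕ → ℝ := fun w => if w = 0 then M else min M (D / (w : ℝ) ^ 4) with hφ
  have hφ0 : ∀ w, 0 ≤ φ w := fun w => by
    simp only [hφ]; split_ifs
    · exact hM0
    · exact le_min hM0 (by positivity)
  have hmaj : ∀ n : ZMod K, ‖cycleHeatGrad K s n‖ ≤ φ (n.valMinAbs.natAbs) := by
    intro n
    have hMn : ‖cycleHeatGrad K s n‖ ≤ M := norm_cycleHeatGrad_le_two_div hs n
    by_cases hn : n = 0
    · have : n.valMinAbs.natAbs = 0 := by rw [hn]; simp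
      simp only [hφ, this, if_true]; exact hMn
    · have hne : n.valMinAbs.natAbs ≠ 0 := by rwa [Ne, Int.natAbs_eq_zero, ZMod.valMinAbs_eq_zero]
      simp only [hφ, hne, if_false]
      refine le_min hMn ?_
      have h := norm_cycleHeatGrad_le_decayPoly (K := K) hs hn
      rw [← hr] at h
      exact h
  have h1 : ∑ n : ZMod K, ‖cycleHeatGrad K s n‖ ≤ ∑ n : ZMod K, φ (n.valMinAbs.natAbs) := Finset.sum_le_sum fun n _ => hmaj n
  have h2 := sum_univ_absV_le (K := K) φ hφ0
  have hφz : φ 0 = M := by simp [hφ]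
  rw [hφz] at h2
  have hg0 : ∀ i : ℕ, 0 ≤ φ (i + 1) := fun i => hφ0 _
  have hgM : ∀ i : ℕ, φ (i + 1) ≤ M := fun i => by simp only [hφ, Nat.succ_ne_zero, if_false]; exact min_le_left _ _
  have hgP : ∀ i : ℕ, φ (i + 1) ≤ D / (((i + 1 : ℕ) : ℝ)) ^ 4 := fun i => by simp only [hφ, Nat.succ_ne_zero, if_false]; exact min_le_right _ _
  have h3 := sum_range_le_head_add_tail hg0 hgM hgP hD0 hρ1 (K / 2)
  -- head `ρ·(2/s) ≤ 30r·2/r² = 60/r`; tail `D/(3ρ³) ≤ 7·13053 r²·8/(3·27000 r³) ≤ 10/r`; `φ(0) = 2/s ≤ 2/r`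
  have hDle : D ≤ 7 * (13053 * r ^ 2) := by
    rw [hD]; exact mul_le_mul_of_nonneg_left (gradDecayPoly_le hr1.le hmix.le) (by norm_num)
  have hhead : (ρ : ℝ) * M ≤ 60 / r := by
    calc (ρ : ℝ) * M ≤ (((30 : ℕ) : ℝ) * r) * (2 / s) := mul_le_mul_of_nonneg_right hρle hM0
      _ = 60 / r := by rw [← hrs]; field_simp; ring
  have htail : D / (3 * (ρ : ℝ) ^ 3) ≤ 10 / r := by
    have hρ3 : ((((30 : ℕ) : ℝ) * r) / 2) ^ 3 ≤ (ρ : ℝ) ^ 3 := pow_le_pow_left₀ (by positivity) hρge 3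
    have hρpos : 0 < (ρ : ℝ) ^ 3 := lt_of_lt_of_le (by positivity) hρ3
    calc D / (3 * (ρ : ℝ) ^ 3) ≤ 7 * (13053 * r ^ 2) / (3 * ((((30 : ℕ) : ℝ) * r) / 2) ^ 3) := by gcongr
      _ = (91371 / 10125) / r := by field_simp; ring
      _ ≤ 10 / r := div_le_div_of_nonneg_right (by norm_num) hr0.le
  have hM2 : M ≤ 2 / r := by
    rw [hM, ← hrs, div_le_div_iff₀ (by positivity) hr0]; nlinarith
  calc ∑ n : ZMod K, ‖cycleHeatGrad K s n‖ ≤ M + 2 * ∑ i ∈ Finset.range (K / 2), φ (i + 1) := h1.trans h2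
    _ ≤ 2 / r + 2 * (60 / r + 10 / r) := by nlinarith [h3, hhead, htail]
    _ = 142 / r := by ring

end Summit.QuantumFields.YangMills.BalabanUVNodes.N15KingModelRung.HeatKernel

end
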